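import Summits.HodgeConjecture.HodgeConjecture.Theses.TropicalWeilObstruction
import Summits.HodgeConjecture.HodgeConjecture.Theorems.TropicalWeilObstructionTropicalWeilVanishingClassPositivityConeExact
import Literature.Analysis.Complex.OneSidedPowerSum
import HarnessLib

/-!
# Route `TropicalWeilObstruction` (Kontsevich's tropical test — NEGATION SINK, exploration, no summit claim):
# class positivity is exhausted by the calibration cone at every Weil period (VI) — positive semidefiniteness ⟺ the cone

Negation-sink bookkeeping of the cell `pub-hodge-tropical` (seat tropical-2 gen 5). Part VI closes the circle of K1-SCOPE §4B (P)(i)–(iii)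
in the kernel, at every Weil period `Q` (`Q ≻ 0`, `QJ = JQ`), for the classes `C(q) = q₀ θ₄(Q) + q₁ Re w(Q) + q₂ Im w(Q)` of K3's `3`-space:

* `sum_omega_mul_omega`, `sum_star_omega_mul_omega` — `Σ_S Ω(S)² = 0`, `Σ_S conj(Ω(S)) Ω(S) = 384` over all `4`-words (`P Pᵀ = 0`,
  `det(P Pᴴ) = 16`, all-maps Cauchy–Binet);
* `quadForm_testVector` — on the test vectors `y_ζ = Re(ζ · conj Ω)`, `ζ ∈ ℂ`, the quadratic form of `C(q)` equals
  `4608 · det M_Q · (q₀ |ζ|² + 8 Re((q₁ − i q₂) ζ²))`;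
* `cone_of_posSemidef` — hence `C(q) ⪰ 0` (as a quadratic form on real functions on words) implies `q₀ ≥ 0` and `64(q₁² + q₂²) ≤ q₀²`:
  positive semidefiniteness — the weakest class-level positivity, implied by "positive combination of frame squares" — already confines
  the class to the calibration cone of p332805 (K1-SCOPE §4B (P)(i), so far prose and an exact script of the referee);
* `posSemidef_of_cone` — conversely every `C(q)` in the cone is `⪰ 0` (Part V: it is a non-negative combination of real frame squares);
* `posSemidef_iff_cone` — the equivalence; `nonneg_frameSquareFunctionals_iff_cone` — the HEADLINE: a class of the `3`-space is `≥ 0` under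
  every functional that is `≥ 0` on saturated integer frame squares iff it lies in the calibration cone. So on K3's `3`-space, at every
  Weil period, CALIBRATION CONE = PSD CONE = the cone of everything class positivity can certify. Effective classes live in it (p332805); K1 says that at a
  very general period they live on its axis; no class-level argument can tell the difference.

HONEST STATUS. Linear algebra; decides nothing about K1 (`TropicalWeilVanishing`, stmt-HodgeConjecture-18478) or about the Hodge conjecture.
No definition, no named fact, no sorry. References: [Zharkov2020TropicalWeil] I. Zharkov, arXiv:2002.02347, §2 (pp. 2–4);
[MikhalkinZharkov2014Eigenwave] G. Mikhalkin, I. Zharkov, LN UMI 15 (2014), Prop. 4.3; [BlekhermanSmithVelasco2016] G. Blekherman,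
G. G. Smith, M. Velasco, JAMS 29 (2016), Thm. 1.1.
-/

set_option linter.dupNamespace false

noncomputable section

open scoped BigOperators
open Matrix
open Literature.AlgebraicGeometry.Tropical
open Summit.HodgeConjecture.HodgeConjecture.Theorems.TropicalHodgeBound

namespace Summit.HodgeConjecture.HodgeConjecture.Theorems.TropicalWeilVanishing.Kappa

/-! ## §0 Display-only notation (verbatim bodies of Parts I–V; nothing is defined) -/

/-- `P = [1 | i·1]`. -/
local notation3 (prettyPrint := false) "𝐏⟦" n "⟧" =>
  (Matrix.of fun (k : Fin n) (a : Fin (2 * n)) =>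
    (if (a : ℕ) = (k : ℕ) then (1 : ℂ) else 0) + (if (a : ℕ) = (k : ℕ) + n then Complex.I else 0))

/-- The skeleton's `thetaClass n Q`. -/
local notation3 (prettyPrint := false) "θ⟦" n "⟧" Q:max =>
  (fun S S' : Fin n → Fin (2 * n) => Matrix.det (Matrix.submatrix Q S S'))

/-- The skeleton's `omegaFrame n` (`Ω = Pᴴ`). -/
local notation3 (prettyPrint := false) "Ω⟦" n "⟧" =>
  (Matrix.of fun (a : Fin (2 * n)) (b : Fin n) =>
    (if (a : ℕ) = (b : ℕ) then (1 : ℂ) else 0) - (if (a : ℕ) = (b : ℕ) + n then Complex.I else 0))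

/-- The skeleton's `weilClassC n Q`. -/
local notation3 (prettyPrint := false) "wC⟦" n "⟧" Q:max =>
  (fun S S' : Fin n → Fin (2 * n) =>
    Matrix.det (Matrix.submatrix (Matrix.map Q ((↑) : ℝ → ℂ) * Ω⟦n⟧) S id) *
      Matrix.det (Matrix.submatrix (Ω⟦n⟧) S' id))

/-- The skeleton's `weilClassRe n Q`. -/
local notation3 (prettyPrint := false) "wRe⟦" n "⟧" Q:max =>
  (fun S S' : Fin n → Fin (2 * n) => Complex.re ((wC⟦n⟧ Q) S S'))

/-- The skeleton's `weilClassIm n Q`. -/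
local notation3 (prettyPrint := false) "wIm⟦" n "⟧" Q:max =>
  (fun S S' : Fin n → Fin (2 * n) => Complex.im ((wC⟦n⟧ Q) S S'))

/-- `M_Q := ½ · P Q Pᴴ`. -/
local notation3 (prettyPrint := false) "𝐌⟦" n "⟧" Q:max =>
  ((2 : ℂ)⁻¹ • (𝐏⟦n⟧ * Matrix.map Q ((↑) : ℝ → ℂ) * (𝐏⟦n⟧)ᴴ))

/-- The square `p_F ⊗ p_F` of the Plücker vector of a real `8 × 4` matrix `F`. -/
local notation3 (prettyPrint := false) "sq⟦" F "⟧" =>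
  (fun S S' : Fin 4 → Fin (2 * 4) =>
    Matrix.det (Matrix.submatrix F S id) * Matrix.det (Matrix.submatrix F S' id))

/-- The `Ω`-minor `Ω(S) := det Ω⟦4⟧[S,·]` of a word `S`. -/
local notation3 (prettyPrint := false) "Ωm" S:max => (Matrix.det (Matrix.submatrix (Ω⟦4⟧) S id))

/-! ## §1 The two `Ω`-sums over all words -/

/-- **`Σ_S Ω(S)² = 0`** over all `4`-words: `ΩᵀΩ = (P Pᵀ)ᴴ = 0` and all-maps Cauchy–Binet. [cite: Zharkov2020TropicalWeil, §2] -/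
theorem sum_omega_mul_omega : ∑ S : Fin 4 → Fin (2 * 4), Ωm S * Ωm S = 0 := by
  have hcb := sum_det_submatrix_mul_det_submatrix ((Ω⟦4⟧)ᵀ) (Ω⟦4⟧)
  have hT : ∀ S : Fin 4 → Fin (2 * 4), (((Ω⟦4⟧)ᵀ).submatrix id S).det = Ωm S := by
    intro S; rw [← Matrix.det_transpose, Matrix.transpose_submatrix, Matrix.transpose_transpose]
  simp_rw [hT] at hcb
  have h0 : (Ω⟦4⟧)ᵀ * Ω⟦4⟧ = 0 := by
    rw [← frame_conjTranspose_eq, ← Matrix.conjTranspose_transpose_eq_transpose_conjTranspose,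
      ← Matrix.conjTranspose_mul, frame_mul_frame_transpose, Matrix.conjTranspose_zero]
  rw [hcb, h0, Matrix.det_zero, mul_zero]

/-- **`Σ_S conj(Ω(S)) · Ω(S) = 384`** over all `4`-words: `ΩᴴΩ = P Pᴴ`, `det(P Pᴴ) = 2⁴`, all-maps Cauchy–Binet.
[cite: Zharkov2020TropicalWeil, §2] -/
theorem sum_star_omega_mul_omega :
    ∑ S : Fin 4 → Fin (2 * 4), (starRingEnd ℂ) (Ωm S) * Ωm S = 384 := by
  have hcb := sum_det_submatrix_mul_det_submatrix ((Ω⟦4⟧)ᴴ) (Ω⟦4⟧)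
  have hH : ∀ S : Fin 4 → Fin (2 * 4), (((Ω⟦4⟧)ᴴ).submatrix id S).det = (starRingEnd ℂ) (Ωm S) := by
    intro S
    rw [show ((Ω⟦4⟧)ᴴ).submatrix id S = (((Ω⟦4⟧)).submatrix S id)ᴴ from by
      rw [Matrix.conjTranspose_submatrix], Matrix.det_conjTranspose, Complex.star_def]
  simp_rw [hH] at hcb
  have h1 : (Ω⟦4⟧)ᴴ * Ω⟦4⟧ = 𝐏⟦4⟧ * (𝐏⟦4⟧)ᴴ := by
    rw [← frame_conjTranspose_eq, Matrix.conjTranspose_conjTranspose]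
  rw [hcb, h1, det_frame_mul_frame_conjTranspose]
  norm_num [Nat.factorial]

/-! ## §2 The quadratic form of `C(q)` on the test vectors `Re(ζ · conj Ω)` -/

/-- `Σ_S Ω(S) · Re(ζ conj Ω(S)) = 192 ζ`. [cite: Zharkov2020TropicalWeil, §2] -/
theorem sum_omega_mul_testVector (ζ : ℂ) :
    ∑ S : Fin 4 → Fin (2 * 4), Ωm S * (((ζ * (starRingEnd ℂ) (Ωm S)).re : ℝ) : ℂ) = 192 * ζ := by
  have h : ∀ S : Fin 4 → Fin (2 * 4), Ωm S * (((ζ * (starRingEnd ℂ) (Ωm S)).re : ℝ) : ℂ) =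
      (ζ * ((starRingEnd ℂ) (Ωm S) * Ωm S) + (starRingEnd ℂ) ζ * (Ωm S * Ωm S)) / 2 := by
    intro S
    rw [Complex.re_eq_add_conj, map_mul, Complex.conj_conj]
    ring
  simp_rw [h]
  rw [← Finset.sum_div, Finset.sum_add_distrib, ← Finset.mul_sum, ← Finset.mul_sum, sum_star_omega_mul_omega,
    sum_omega_mul_omega]
  ring

/-- **The quadratic form of `C(q) = q₀θ₄(Q) + q₁Re w(Q) + q₂Im w(Q)` on `y_ζ = Re(ζ · conj Ω)`** (`Q` commuting with `J`):
`Σ_{S,S'} y_ζ(S) C(S,S') y_ζ(S') = 4608 · Re(det M_Q) · (q₀|ζ|² + 8·Re((q₁ − iq₂)ζ²))` (uses `⋀⁴Q Ω = 4!·det M_Q·Ω`,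
`w(Q) = det M_Q · Ω ⊗ Ω`, `Σ Ω² = 0`, `Σ |Ω|² = 384`, and `det M_Q ∈ ℝ`). [cite: Zharkov2020TropicalWeil, §2] -/
theorem quadForm_testVector (Q : Matrix (Fin (2 * 4)) (Fin (2 * 4)) ℝ) (hJ : Q * weilJ 4 = weilJ 4 * Q)
    (hreal : ((𝐌⟦4⟧ Q).det).im = 0) (q0 q1 q2 : ℝ) (ζ : ℂ) :
    ∑ S : Fin 4 → Fin (2 * 4), ∑ S' : Fin 4 → Fin (2 * 4),
        (ζ * (starRingEnd ℂ) (Ωm S)).re * (q0 • θ⟦4⟧ Q + q1 • wRe⟦4⟧ Q + q2 • wIm⟦4⟧ Q) S S' *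
          (ζ * (starRingEnd ℂ) (Ωm S')).re =
      4608 * ((𝐌⟦4⟧ Q).det).re * (q0 * ‖ζ‖ ^ 2 + 8 * ((((q1 : ℂ) - Complex.I * (q2 : ℂ)) * ζ ^ 2).re)) := by
  set m : ℂ := (𝐌⟦4⟧ Q).det with hm
  obtain ⟨y, hy⟩ : ∃ y : (Fin 4 → Fin (2 * 4)) → ℝ, y = fun S => (ζ * (starRingEnd ℂ) (Ωm S)).re := ⟨_, rfl⟩
  have hyS : ∀ S, (ζ * (starRingEnd ℂ) (Ωm S)).re = y S := fun S => by rw [hy]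
  simp_rw [hyS]
  set K : ℂ := (q1 : ℂ) - Complex.I * (q2 : ℂ) with hK
  -- the entries of `C`, in complex form
  have hC : ∀ S S' : Fin 4 → Fin (2 * 4), (q0 • θ⟦4⟧ Q + q1 • wRe⟦4⟧ Q + q2 • wIm⟦4⟧ Q) S S' =
      q0 * (Q.submatrix S S').det + ((K * (m * (Ωm S * Ωm S'))).re) := by
    intro S S'
    have h1 : (q0 • θ⟦4⟧ Q + q1 • wRe⟦4⟧ Q + q2 • wIm⟦4⟧ Q) S S' =
        q0 * (Q.submatrix S S').det + q1 * ((wC⟦4⟧ Q) S S').re + q2 * ((wC⟦4⟧ Q) S S').im := by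
      simp only [Pi.add_apply, Pi.smul_apply, smul_eq_mul]
    rw [h1, weilClassC_eq_det_mul Q hJ S S', hK]
    simp only [Complex.mul_re, Complex.sub_re, Complex.sub_im, Complex.ofReal_re, Complex.ofReal_im, Complex.mul_im,
      Complex.I_re, Complex.I_im]
    ring
  -- the two scalar sums against `y`
  have hs : ∑ S : Fin 4 → Fin (2 * 4), Ωm S * ((y S : ℝ) : ℂ) = 192 * ζ := by
    rw [hy]; exact sum_omega_mul_testVector ζ
  have hθrow : ∀ S : Fin 4 → Fin (2 * 4),
      ∑ S', (Q.submatrix S S').det * y S' = (ζ * (starRingEnd ℂ) (24 * (m * Ωm S))).re := by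
    intro S
    have h1 : ∑ S', (Q.submatrix S S').det * y S' =
        (∑ S' : Fin 4 → Fin (2 * 4), (((Q.submatrix S S').det : ℝ) : ℂ) * (ζ * (starRingEnd ℂ) (Ωm S'))).re := by
      rw [Complex.re_sum, hy]
      exact Finset.sum_congr rfl fun S' _ => by rw [Complex.re_ofReal_mul]
    have h2 : ∑ S' : Fin 4 → Fin (2 * 4), (((Q.submatrix S S').det : ℝ) : ℂ) * (ζ * (starRingEnd ℂ) (Ωm S')) =
        ζ * (starRingEnd ℂ) (∑ S' : Fin 4 → Fin (2 * 4), (((Q.submatrix S S').det : ℝ) : ℂ) * Ωm S') := by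
      rw [map_sum, Finset.mul_sum]
      refine Finset.sum_congr rfl fun S' _ => ?_
      rw [map_mul, Complex.conj_ofReal]
      ring
    rw [h1, h2, sum_det_submatrix_mul_omega Q hJ S]
  have hθ : ∑ S, ∑ S', y S * (Q.submatrix S S').det * y S' = 4608 * m.re * ‖ζ‖ ^ 2 := by
    have h1 : ∀ S, ∑ S', y S * (Q.submatrix S S').det * y S' = y S * (ζ * (starRingEnd ℂ) (24 * (m * Ωm S))).re := by
      intro S
      rw [← hθrow S, Finset.mul_sum]
      exact Finset.sum_congr rfl fun S' _ => by ring
    have h2 : ∀ S, y S * (ζ * (starRingEnd ℂ) (24 * (m * Ωm S))).re =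
        (((ζ * (starRingEnd ℂ) (Ωm S)) * (ζ * (starRingEnd ℂ) (24 * (m * Ωm S)))).re +
          ((ζ * (starRingEnd ℂ) (Ωm S)) * (starRingEnd ℂ) (ζ * (starRingEnd ℂ) (24 * (m * Ωm S)))).re) / 2 := by
      intro S; rw [← hyS S]; exact Literature.Analysis.Complex.PowerSum.re_mul_re_eq _ _
    simp_rw [h1, h2]
    rw [← Finset.sum_div, Finset.sum_add_distrib, ← Complex.re_sum, ← Complex.re_sum]
    have hA : ∑ S : Fin 4 → Fin (2 * 4), (ζ * (starRingEnd ℂ) (Ωm S)) * (ζ * (starRingEnd ℂ) (24 * (m * Ωm S))) =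
        24 * ζ ^ 2 * (starRingEnd ℂ) m * (starRingEnd ℂ) (∑ S : Fin 4 → Fin (2 * 4), Ωm S * Ωm S) := by
      rw [map_sum, Finset.mul_sum]
      refine Finset.sum_congr rfl fun S _ => ?_
      simp only [map_mul, map_ofNat]
      ring
    have hB : ∑ S : Fin 4 → Fin (2 * 4), (ζ * (starRingEnd ℂ) (Ωm S)) *
        (starRingEnd ℂ) (ζ * (starRingEnd ℂ) (24 * (m * Ωm S))) =
        24 * (ζ * (starRingEnd ℂ) ζ) * m * ∑ S : Fin 4 → Fin (2 * 4), (starRingEnd ℂ) (Ωm S) * Ωm S := by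
      rw [Finset.mul_sum]
      refine Finset.sum_congr rfl fun S _ => ?_
      simp only [map_mul, map_ofNat, Complex.conj_conj]
      ring
    rw [hA, hB, sum_omega_mul_omega, sum_star_omega_mul_omega, map_zero, mul_zero, Complex.zero_re, zero_add,
      Complex.mul_conj, ← Complex.sq_norm]
    have e : (24 * ((‖ζ‖ ^ 2 : ℝ) : ℂ) * m * 384).re = 9216 * m.re * ‖ζ‖ ^ 2 := by
      rw [show (24 : ℂ) * ((‖ζ‖ ^ 2 : ℝ) : ℂ) * m * 384 = (((9216 * ‖ζ‖ ^ 2 : ℝ)) : ℂ) * m by push_cast; ring,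
        Complex.re_ofReal_mul]
      ring
    rw [e]
    ring
  -- the Weil part
  have hW : ∑ S, ∑ S', y S * ((K * (m * (Ωm S * Ωm S'))).re) * y S' = 36864 * ((K * m * ζ ^ 2).re) := by
    have h1 : ∀ S S', y S * ((K * (m * (Ωm S * Ωm S'))).re) * y S' =
        ((K * m) * ((Ωm S * ((y S : ℝ) : ℂ)) * (Ωm S' * ((y S' : ℝ) : ℂ)))).re := by
      intro S S'
      rw [show (K * m) * ((Ωm S * ((y S : ℝ) : ℂ)) * (Ωm S' * ((y S' : ℝ) : ℂ))) =
          ((y S * y S' : ℝ) : ℂ) * (K * (m * (Ωm S * Ωm S'))) by push_cast; ring, Complex.re_ofReal_mul]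
      ring
    calc ∑ S, ∑ S', y S * ((K * (m * (Ωm S * Ωm S'))).re) * y S'
        = ∑ S : Fin 4 → Fin (2 * 4), ∑ S' : Fin 4 → Fin (2 * 4),
            ((K * m) * ((Ωm S * ((y S : ℝ) : ℂ)) * (Ωm S' * ((y S' : ℝ) : ℂ)))).re := by simp_rw [h1]
      _ = (∑ S : Fin 4 → Fin (2 * 4), ∑ S' : Fin 4 → Fin (2 * 4),
            (K * m) * ((Ωm S * ((y S : ℝ) : ℂ)) * (Ωm S' * ((y S' : ℝ) : ℂ)))).re := by
          rw [Complex.re_sum]; simp_rw [Complex.re_sum]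
      _ = ((K * m) * ((∑ S : Fin 4 → Fin (2 * 4), Ωm S * ((y S : ℝ) : ℂ)) *
            (∑ S' : Fin 4 → Fin (2 * 4), Ωm S' * ((y S' : ℝ) : ℂ)))).re := by
          congr 1
          rw [Finset.sum_mul_sum, Finset.mul_sum]
          refine Finset.sum_congr rfl fun S _ => ?_
          rw [Finset.mul_sum]
      _ = 36864 * ((K * m * ζ ^ 2).re) := by
          rw [hs, show (K * m) * ((192 * ζ) * (192 * ζ)) = ((36864 : ℝ) : ℂ) * (K * m * ζ ^ 2) by push_cast; ring,
            Complex.re_ofReal_mul]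
  -- assemble
  calc ∑ S : Fin 4 → Fin (2 * 4), ∑ S' : Fin 4 → Fin (2 * 4),
        y S * (q0 • θ⟦4⟧ Q + q1 • wRe⟦4⟧ Q + q2 • wIm⟦4⟧ Q) S S' * y S'
      = ∑ S, ∑ S', y S * (q0 * (Q.submatrix S S').det + ((K * (m * (Ωm S * Ωm S'))).re)) * y S' := by
        simp_rw [hC]
    _ = q0 * ∑ S, ∑ S', y S * (Q.submatrix S S').det * y S' +
          ∑ S, ∑ S', y S * ((K * (m * (Ωm S * Ωm S'))).re) * y S' := by
        rw [Finset.mul_sum, ← Finset.sum_add_distrib]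
        refine Finset.sum_congr rfl fun S _ => ?_
        rw [Finset.mul_sum, ← Finset.sum_add_distrib]
        exact Finset.sum_congr rfl fun S' _ => by ring
    _ = 4608 * m.re * (q0 * ‖ζ‖ ^ 2 + 8 * ((K * ζ ^ 2).re)) := by
        rw [hθ, hW]
        have e : (K * m * ζ ^ 2).re = m.re * ((K * ζ ^ 2).re) := by
          rw [show K * m * ζ ^ 2 = m * (K * ζ ^ 2) by ring, ← Complex.re_add_im m, hreal]
          simp
        rw [e]
        ring

/-! ## §3 Positive semidefiniteness ⟺ the calibration cone -/

/-- **PSD ⟹ cone.** At a Weil period (`Q ≻ 0`, `QJ = JQ`), if the table `C(q) = q₀θ₄(Q) + q₁Re w(Q) + q₂Im w(Q)` is positive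
semidefinite as a quadratic form on real functions on words, then `q₀ ≥ 0` and `64(q₁² + q₂²) ≤ q₀²` (test vectors `Re(ζ · conj Ω)` with
`ζ² ∥ -(q₁ + iq₂)`). K1-SCOPE §4B (P)(i) in the kernel, at every period. [cite: Zharkov2020TropicalWeil, §2] -/
theorem cone_of_posSemidef (Q : Matrix (Fin (2 * 4)) (Fin (2 * 4)) ℝ) (hQ : Q.PosDef) (hJ : Q * weilJ 4 = weilJ 4 * Q)
    (q0 q1 q2 : ℝ)
    (hpsd : ∀ y : (Fin 4 → Fin (2 * 4)) → ℝ,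
      0 ≤ ∑ S : Fin 4 → Fin (2 * 4), ∑ S' : Fin 4 → Fin (2 * 4),
        y S * (q0 • θ⟦4⟧ Q + q1 • wRe⟦4⟧ Q + q2 • wIm⟦4⟧ Q) S S' * y S') :
    0 ≤ q0 ∧ 64 * (q1 ^ 2 + q2 ^ 2) ≤ q0 ^ 2 := by
  obtain ⟨hDre, hDim⟩ := det_frame_mul_map_mul_conjTranspose_pos Q hQ
  have hMdet : (𝐌⟦4⟧ Q).det = (2 : ℂ)⁻¹ ^ 4 * (𝐏⟦4⟧ * Q.map ((↑) : ℝ → ℂ) * (𝐏⟦4⟧)ᴴ).det := by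
    rw [Matrix.det_smul, Fintype.card_fin]
  have hreal : ((𝐌⟦4⟧ Q).det).im = 0 := by
    rw [hMdet, show ((2 : ℂ)⁻¹) ^ 4 = (((2 : ℝ)⁻¹ ^ 4 : ℝ) : ℂ) by push_cast; ring, Complex.im_ofReal_mul, hDim, mul_zero]
  have hmpos : 0 < ((𝐌⟦4⟧ Q).det).re := by
    rw [hMdet, show ((2 : ℂ)⁻¹) ^ 4 = (((2 : ℝ)⁻¹ ^ 4 : ℝ) : ℂ) by push_cast; ring, Complex.re_ofReal_mul]
    positivity
  -- the basic inequality on every `ζ`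
  have key : ∀ ζ : ℂ, 0 ≤ q0 * ‖ζ‖ ^ 2 + 8 * ((((q1 : ℂ) - Complex.I * (q2 : ℂ)) * ζ ^ 2).re) := by
    intro ζ
    have h := hpsd fun S => (ζ * (starRingEnd ℂ) (Ωm S)).re
    rw [quadForm_testVector Q hJ hreal q0 q1 q2 ζ] at h
    have h4608 : (0 : ℝ) < 4608 * ((𝐌⟦4⟧ Q).det).re := by positivity
    by_contra hneg
    push Not at hneg
    have := mul_neg_of_pos_of_neg h4608 hneg
    linarith
  -- `ζ = 1`: `q₀ + 8 q₁ ≥ 0`; `ζ = i`: `q₀ - 8 q₁ ≥ 0`; hence `q₀ ≥ 0`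
  have h1 := key 1
  have hi := key Complex.I
  simp only [norm_one, one_pow, mul_one, Complex.I_sq, mul_neg, Complex.neg_re, Complex.sub_re, Complex.ofReal_re,
    Complex.mul_re, Complex.I_re, Complex.ofReal_im, Complex.I_im, Complex.norm_I] at h1 hi
  refine ⟨by linarith, ?_⟩
  -- a square root of the unit vector `-(q₁ + i q₂)/r`
  by_cases hr : q1 ^ 2 + q2 ^ 2 = 0
  · rw [hr]; nlinarith
  · have hrpos : 0 < q1 ^ 2 + q2 ^ 2 := lt_of_le_of_ne (by positivity) (Ne.symm hr)
    set r : ℝ := Real.sqrt (q1 ^ 2 + q2 ^ 2) with hrdef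
    have hr0 : 0 < r := Real.sqrt_pos.mpr hrpos
    have hr2 : r ^ 2 = q1 ^ 2 + q2 ^ 2 := Real.sq_sqrt hrpos.le
    obtain ⟨ζ, hζ⟩ := IsAlgClosed.exists_pow_nat_eq (-(((q1 : ℂ) + Complex.I * (q2 : ℂ)) / (r : ℂ))) (by norm_num : 0 < 2)
    have hu : Complex.normSq (-(((q1 : ℂ) + Complex.I * (q2 : ℂ)) / (r : ℂ))) = 1 := by
      rw [Complex.normSq_neg, Complex.normSq_div, Complex.normSq_ofReal, Complex.normSq_apply]
      simp only [Complex.add_re, Complex.ofReal_re, Complex.mul_re, Complex.I_re, Complex.ofReal_im, Complex.I_im,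
        Complex.add_im, Complex.mul_im]
      rw [div_eq_one_iff_eq (by positivity)]
      nlinarith [hr2]
    have hζn : ‖ζ‖ ^ 2 = 1 := by
      have h2 : (‖ζ‖ ^ 2) ^ 2 = 1 := by
        rw [← pow_mul, show 2 * 2 = 4 by norm_num, show ‖ζ‖ ^ 4 = ‖ζ ^ 2‖ ^ 2 by rw [norm_pow]; ring, hζ,
          Complex.sq_norm, hu]
      nlinarith [norm_nonneg ζ, h2, sq_nonneg (‖ζ‖ ^ 2 + 1)]
    have hprod : (((q1 : ℂ) - Complex.I * (q2 : ℂ)) * ζ ^ 2).re = -r := by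
      rw [hζ]
      have hr0' : (r : ℂ) ≠ 0 := by exact_mod_cast hr0.ne'
      have e : ((q1 : ℂ) - Complex.I * (q2 : ℂ)) * -(((q1 : ℂ) + Complex.I * (q2 : ℂ)) / (r : ℂ)) =
          (((-(q1 ^ 2 + q2 ^ 2) / r : ℝ)) : ℂ) := by
        push_cast
        field_simp
        ring_nf
        rw [Complex.I_sq]
        ring
      rw [e, Complex.ofReal_re, ← hr2]
      field_simp
    have h := key ζ
    rw [hζn, hprod] at h
    nlinarith [h, hr2, hr0]

/-- **The quadratic form of a table on a real vector is a class-positivity functional:** if every linear functional that is `≥ 0`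
on all saturated integer frame squares is `≥ 0` on `C`, then `C ⪰ 0` (the evaluation `C ↦ Σ y(S) C(S,S') y(S')` is such a
functional: on a frame square it is `(Σ_S y(S) p_L(S))² ≥ 0`). [folklore] -/
theorem quadForm_nonneg_of_nonneg_frameSquareFunctionals (C : (Fin 4 → Fin (2 * 4)) → (Fin 4 → Fin (2 * 4)) → ℝ)
    (hC : ∀ Φ : ((Fin 4 → Fin (2 * 4)) → (Fin 4 → Fin (2 * 4)) → ℝ) →ₗ[ℝ] ℝ,
      (∀ L : Matrix (Fin (2 * 4)) (Fin 4) ℤ, (∃ M : Matrix (Fin 4) (Fin (2 * 4)) ℤ, M * L = 1) →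
        0 ≤ Φ (fun S S' => ((pluckerCoord L S : ℤ) : ℝ) * ((pluckerCoord L S' : ℤ) : ℝ))) → 0 ≤ Φ C)
    (y : (Fin 4 → Fin (2 * 4)) → ℝ) :
    0 ≤ ∑ S : Fin 4 → Fin (2 * 4), ∑ S' : Fin 4 → Fin (2 * 4), y S * C S S' * y S' := by
  classical
  let Φ : ((Fin 4 → Fin (2 * 4)) → (Fin 4 → Fin (2 * 4)) → ℝ) →ₗ[ℝ] ℝ :=
    { toFun := fun D => ∑ S, ∑ S', y S * D S S' * y S'
      map_add' := fun D E => by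
        simp only [Pi.add_apply, mul_add, add_mul, Finset.sum_add_distrib]
      map_smul' := fun c D => by
        simp only [Pi.smul_apply, smul_eq_mul, RingHom.id_apply, Finset.mul_sum]
        exact Finset.sum_congr rfl fun S _ => Finset.sum_congr rfl fun S' _ => by ring }
  have hΦ : ∀ L : Matrix (Fin (2 * 4)) (Fin 4) ℤ, (∃ M : Matrix (Fin 4) (Fin (2 * 4)) ℤ, M * L = 1) →
      0 ≤ Φ (fun S S' => ((pluckerCoord L S : ℤ) : ℝ) * ((pluckerCoord L S' : ℤ) : ℝ)) := by
    intro L _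
    show 0 ≤ ∑ S, ∑ S', y S * (((pluckerCoord L S : ℤ) : ℝ) * ((pluckerCoord L S' : ℤ) : ℝ)) * y S'
    have e : ∑ S : Fin 4 → Fin (2 * 4), ∑ S' : Fin 4 → Fin (2 * 4),
        y S * (((pluckerCoord L S : ℤ) : ℝ) * ((pluckerCoord L S' : ℤ) : ℝ)) * y S' =
        (∑ S : Fin 4 → Fin (2 * 4), y S * ((pluckerCoord L S : ℤ) : ℝ)) ^ 2 := by
      rw [sq, Finset.sum_mul_sum]
      exact Finset.sum_congr rfl fun S _ => Finset.sum_congr rfl fun S' _ => by ring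
    rw [e]
    exact sq_nonneg _
  exact hC Φ hΦ

/-- **Cone ⟹ PSD.** Every class `q₀θ₄(Q) + q₁Re w(Q) + q₂Im w(Q)` with `q₀ ≥ 0`, `64(q₁²+q₂²) ≤ q₀²` is positive semidefinite (Part V: every
class-positivity functional is `≥ 0` on it, in particular the quadratic forms). [cite: Zharkov2020TropicalWeil, §2] -/
theorem posSemidef_of_cone (Q : Matrix (Fin (2 * 4)) (Fin (2 * 4)) ℝ) (hQ : Q.PosDef) (hJ : Q * weilJ 4 = weilJ 4 * Q)
    (q0 q1 q2 : ℝ) (hq0 : 0 ≤ q0) (hcone : 64 * (q1 ^ 2 + q2 ^ 2) ≤ q0 ^ 2) (y : (Fin 4 → Fin (2 * 4)) → ℝ) :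
    0 ≤ ∑ S : Fin 4 → Fin (2 * 4), ∑ S' : Fin 4 → Fin (2 * 4),
      y S * (q0 • θ⟦4⟧ Q + q1 • wRe⟦4⟧ Q + q2 • wIm⟦4⟧ Q) S S' * y S' :=
  quadForm_nonneg_of_nonneg_frameSquareFunctionals _
    (fun Φ hΦ => nonneg_on_calibrationCone_of_nonneg_frameSquares Φ hΦ Q hQ hJ q0 q1 q2 hq0 hcone) y

/-- **PSD ⟺ cone, at every Weil period.** For `Q ≻ 0` commuting with `J`: `q₀θ₄(Q) + q₁Re w(Q) + q₂Im w(Q) ⪰ 0` iff `q₀ ≥ 0` and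
`64(q₁² + q₂²) ≤ q₀²`. (K1-SCOPE §4B (P)(i); decides nothing about K1 or HC.) [cite: Zharkov2020TropicalWeil, §2]
[cite: BlekhermanSmithVelasco2016, Thm. 1.1] -/
theorem posSemidef_iff_cone (Q : Matrix (Fin (2 * 4)) (Fin (2 * 4)) ℝ) (hQ : Q.PosDef) (hJ : Q * weilJ 4 = weilJ 4 * Q)
    (q0 q1 q2 : ℝ) :
    (∀ y : (Fin 4 → Fin (2 * 4)) → ℝ,
      0 ≤ ∑ S : Fin 4 → Fin (2 * 4), ∑ S' : Fin 4 → Fin (2 * 4),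
        y S * (q0 • θ⟦4⟧ Q + q1 • wRe⟦4⟧ Q + q2 • wIm⟦4⟧ Q) S S' * y S') ↔
      (0 ≤ q0 ∧ 64 * (q1 ^ 2 + q2 ^ 2) ≤ q0 ^ 2) :=
  ⟨cone_of_posSemidef Q hQ hJ q0 q1 q2, fun h y => posSemidef_of_cone Q hQ hJ q0 q1 q2 h.1 h.2 y⟩

/-- **HEADLINE: class positivity ⟺ the calibration cone, at every Weil period.** For `Q ≻ 0` commuting with `J` and real `q₀, q₁, q₂`,
the following are equivalent for the class `C = q₀θ₄(Q) + q₁Re w(Q) + q₂Im w(Q)` of K3's `3`-space: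
(a) every ℝ-linear functional on the class space that is `≥ 0` on all squares `p_L ⊗ p_L` of Plücker vectors of SATURATED INTEGER frames
— i.e. every class-level necessary condition for effectivity of tropical `4`-cycles (`Kappa.nonneg_cyc_of_nonneg_frameSquares`) — is `≥ 0`
on `C`; (b) `q₀ ≥ 0` and `64(q₁² + q₂²) ≤ q₀²` (the calibration cone of p332805). ((a) ⟹ PSD by the quadratic-form functionals ⟹ (b) by
`cone_of_posSemidef`; (b) ⟹ (a) is Part V.) So at the very general periods where K1 lives, the calibration cone is EXACTLY what
class-level positivity can certify; K1 ("effective classes lie on the axis q₁ = q₂ = 0") is a statement no such argument reaches.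
Decides nothing about K1 or HC. [cite: Zharkov2020TropicalWeil, §2] [cite: BlekhermanSmithVelasco2016, Thm. 1.1] -/
theorem nonneg_frameSquareFunctionals_iff_cone (Q : Matrix (Fin (2 * 4)) (Fin (2 * 4)) ℝ) (hQ : Q.PosDef)
    (hJ : Q * weilJ 4 = weilJ 4 * Q) (q0 q1 q2 : ℝ) :
    (∀ Φ : ((Fin 4 → Fin (2 * 4)) → (Fin 4 → Fin (2 * 4)) → ℝ) →ₗ[ℝ] ℝ,
      (∀ L : Matrix (Fin (2 * 4)) (Fin 4) ℤ, (∃ M : Matrix (Fin 4) (Fin (2 * 4)) ℤ, M * L = 1) →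
        0 ≤ Φ (fun S S' => ((pluckerCoord L S : ℤ) : ℝ) * ((pluckerCoord L S' : ℤ) : ℝ))) →
      0 ≤ Φ (q0 • θ⟦4⟧ Q + q1 • wRe⟦4⟧ Q + q2 • wIm⟦4⟧ Q)) ↔
      (0 ≤ q0 ∧ 64 * (q1 ^ 2 + q2 ^ 2) ≤ q0 ^ 2) :=
  ⟨fun h => cone_of_posSemidef Q hQ hJ q0 q1 q2 (quadForm_nonneg_of_nonneg_frameSquareFunctionals _ h),
    fun h Φ hΦ => nonneg_on_calibrationCone_of_nonneg_frameSquares Φ hΦ Q hQ hJ q0 q1 q2 h.1 h.2⟩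

end Summit.HodgeConjecture.HodgeConjecture.Theorems.TropicalWeilVanishing.Kappa

end
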